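import Mathlib
import Summits.MatrixMultiplication.MatrixMultiplication.Theses.SuccinctSecantEquations

/-!
# Birth skeleton (BC3) of piece `SuccinctSeparationBeyondConstants` of the split of `SuccinctSeparation` (stmt-MatrixMultiplication-7986)

Two named stubs and the kernel-checked composition `SuccinctSeparationBeyondConstants_of`; identical to the corresponding section of the
registered line `Cruxes/SuccinctSeparation/Lines/seed-tensorise.lean` (namespace `…SeedTensorise`), extracted so the
piece carries its own certificate.  `lean check`: rc 0, sorries = 2 (the stubs), none elsewhere.
-/

set_option linter.dupNamespace false

noncomputable section

namespace Summit.MatrixMultiplication.MatrixMultiplication.Cruxes.SuccinctSeparation.BirthBeyondConstants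

/-! ## Statements -/

/-- Piece 1 of the split, verbatim: SUCCINCT SEPARATION BEYOND CONSTANTS. -/
def SuccinctSeparationBeyondConstants : Prop := ∃ a : ℕ, ∀ K : ℕ, ∃ n r : ℕ, K ≤ n ∧ K * n ^ 2 ≤ r ∧ ∃ F : MvPolynomial ((Fin n × Fin n) × (Fin n × Fin n) × (Fin n × Fin n)) ℂ, Literature.Computability.AlgebraicComplexity.complexity F ≤ n ^ a ∧ (∀ T : Fin n × Fin n → Fin n × Fin n → Fin n × Fin n → ℂ, Literature.Computability.AlgebraicComplexity.tensorRank T ≤ r → MvPolynomial.eval (fun p => T p.1 p.2.1 p.2.2) F = 0) ∧ MvPolynomial.eval (fun p => Literature.Computability.AlgebraicComplexity.matMulTensor ℂ n n n p.1 p.2.1 p.2.2) F ≠ 0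

/-- Stub 1 statement: a SUCCINCT POLYNOMIAL RANK METHOD beyond every constant multiple of `n²`, at `⟨n,n,n⟩`. -/
def RankMethodBeyondConstants : Prop :=
  ∃ a : ℕ, ∀ K : ℕ, ∃ n r P Q g : ℕ, K ≤ n ∧ K * n ^ 2 ≤ r ∧ P ≤ n ^ a ∧ Q ≤ n ^ a ∧
    ∃ Φ : Matrix (Fin P) (Fin Q) (MvPolynomial ((Fin n × Fin n) × (Fin n × Fin n) × (Fin n × Fin n)) ℂ),
      (∀ i j, Literature.Computability.AlgebraicComplexity.complexity (Φ i j) ≤ n ^ a) ∧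
      (∀ T : Fin n × Fin n → Fin n × Fin n → Fin n × Fin n → ℂ,
        Literature.Computability.AlgebraicComplexity.tensorRank T ≤ r →
          (Φ.map (MvPolynomial.eval (fun p => T p.1 p.2.1 p.2.2))).rank ≤ g) ∧
      g < (Φ.map (MvPolynomial.eval (fun p =>
        Literature.Computability.AlgebraicComplexity.matMulTensor ℂ n n n p.1 p.2.1 p.2.2))).rank

/-- Stub 2 statement: MINORS OF SUCCINCT RANK METHODS ARE SUCCINCT SEPARATIONS (one output exponent `b` per input
exponent `a`). -/
def MinorExtraction : Prop :=
  ∀ a : ℕ, ∃ b : ℕ, ∀ (n r P Q g : ℕ)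
    (Φ : Matrix (Fin P) (Fin Q) (MvPolynomial ((Fin n × Fin n) × (Fin n × Fin n) × (Fin n × Fin n)) ℂ)),
    2 ≤ n → P ≤ n ^ a → Q ≤ n ^ a →
    (∀ i j, Literature.Computability.AlgebraicComplexity.complexity (Φ i j) ≤ n ^ a) →
    (∀ T : Fin n × Fin n → Fin n × Fin n → Fin n × Fin n → ℂ,
      Literature.Computability.AlgebraicComplexity.tensorRank T ≤ r →
        (Φ.map (MvPolynomial.eval (fun p => T p.1 p.2.1 p.2.2))).rank ≤ g) →
    g < (Φ.map (MvPolynomial.eval (fun p =>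
      Literature.Computability.AlgebraicComplexity.matMulTensor ℂ n n n p.1 p.2.1 p.2.2))).rank →
    ∃ F : MvPolynomial ((Fin n × Fin n) × (Fin n × Fin n) × (Fin n × Fin n)) ℂ,
      Literature.Computability.AlgebraicComplexity.complexity F ≤ n ^ b ∧
      (∀ T : Fin n × Fin n → Fin n × Fin n → Fin n × Fin n → ℂ,
        Literature.Computability.AlgebraicComplexity.tensorRank T ≤ r →
          MvPolynomial.eval (fun p => T p.1 p.2.1 p.2.2) F = 0) ∧
      MvPolynomial.eval (fun p =>
        Literature.Computability.AlgebraicComplexity.matMulTensor ℂ n n n p.1 p.2.1 p.2.2) F ≠ 0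

/-! ## Stubs -/

/-- STUB 1 (hardest; the open content of piece 1): a succinct polynomial rank method beyond every constant. -/
theorem stub_rankMethodBeyondConstants : RankMethodBeyondConstants := by
  sorry

/-- STUB 2 (provable, L): a non-vanishing `(g+1)`-minor at `⟨n,n,n⟩` of a succinct rank method is a succinct
separation (Berkowitz `complexity_detPoly_le` + substitution `complexity_aeval_le`). -/
theorem stub_minorExtraction : MinorExtraction := by
  sorry

/-! ## Composition (no sorry below) -/

/-- Stubs 1 + 2 give piece 1: run the rank method at `max K 2` (so `n ≥ 2`) and extract a minor. [folklore] -/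
theorem beyondConstants_of (h1 : RankMethodBeyondConstants) (h2 : MinorExtraction) :
    SuccinctSeparationBeyondConstants := by
  obtain ⟨a, h⟩ := h1
  obtain ⟨b, hb⟩ := h2 a
  refine ⟨b, fun K => ?_⟩
  obtain ⟨n, r, P, Q, g, hKn, hKr, hP, hQ, Φ, hΦc, hΦr, hΦm⟩ := h (max K 2)
  have hn2 : 2 ≤ n := le_trans (le_max_right K 2) hKn
  obtain ⟨F, hFc, hFv, hFm⟩ := hb n r P Q g Φ hn2 hP hQ hΦc hΦr hΦm
  exact ⟨n, r, le_trans (le_max_left K 2) hKn,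
    le_trans (Nat.mul_le_mul_right _ (le_max_left K 2)) hKr, F, hFc, hFv, hFm⟩

/-- BC3 composition under the canonical name `<C>_of`. [folklore] -/
theorem SuccinctSeparationBeyondConstants_of :
    RankMethodBeyondConstants → MinorExtraction → SuccinctSeparationBeyondConstants :=
  beyondConstants_of

/-- The piece from its registered stubs by name. [folklore] -/
theorem SuccinctSeparationBeyondConstants_holds_of_stubs : SuccinctSeparationBeyondConstants :=
  SuccinctSeparationBeyondConstants_of stub_rankMethodBeyondConstants stub_minorExtraction

end Summit.MatrixMultiplication.MatrixMultiplication.Cruxes.SuccinctSeparation.BirthBeyondConstants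

end
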